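import Summits.QuantumFields.YangMills.Theorems.BalabanUVNodesN15PerCubeGreenSopCloseScaled
import HarnessLib

/-!
# N15 = NE2, road (c) — PROGRAMME (PC), (PC-B): THE ROW OF `Q′G′²Q′ᵀ(U)` AT ITS NATURAL SCALE `(L^k)^{−(d+1)}` for a `U(m)` field in Bałaban's per-cube class (dag-n15-c g28, n15-c∕299a′)

Cell `pub-ymgap`, seat `pub-ymgap-dag-n15-c` (generation g28; R134 (a), s1; HUMAN RULING D-0062).  `bears_on: R4∕N15 · K3⁸ SpineGivenEndpointR13SepCoPHV (stmt-QuantumFields-27366)`;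
filed `--kind proof --supports stmt-QuantumFields-27366 --as helper` — COUNT-NEUTRAL.  0 `def`, 0 `sorry`.  Imports n15-c∕299a `…PerCubeGreenSopCloseScaled` (through it n15-c∕266
`hasMaj_cGreen_of_reg335Box`, n15-c∕202∕205 `hasMaj_csavg(_transpose)`, n15-c∕298a `rows/cols_cvaStair_cvT_le`, `HasMaj.diag_const_exp`, dag-n15-a `hasMaj_smul_ofBlocks`, [B11] `hasMaj_comp_exp`).
Nothing in the tree is modified.

WHY ((PC-B), [B9] (3.95)–(3.96) p.411).  The commutator row `[S(V_□), M_{h_□}]·S(𝟙)⁻¹` of the per-cube expansion of `(Q′G′²Q′ᵀ)⁻¹(U)` needs the row of `S(V) = Q′G′²Q′ᵀ(V)` at the scale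
`n^{−(d+1)}` of `Q′ᵀ` (against `S(𝟙)⁻¹ ~ C_S n^{d+1}`, n15-c∕222b): ★★ `hasMaj_cSop_of_reg335Box` — `mulVecLin (cSop (cvT e U) a_K) ≤ B·((L^k)^{d+1})⁻¹·e^{−δ|y−y′|_T}` on the coarse coloured
scalars for `U` in the class (3.35) on the two-collar box of every cut box (n15-c∕266's hypotheses literally), by composing `Q′(U)` (rows `|ι|`), `G′(U)` (266) twice and `(L^k)^{d+1}·Q′(U)ᵀ`
(rows `|ι|`) and scaling back.

HONEST FRAMING ∕ LIMITS.  MODEL carriers (n15-c∕262's cover of the doubled unit torus); no operator of record estimated; [B9] cited for SHAPES ∕ MECHANISM.  NE2⁺ NOT PRINTED, NOT proved;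
N15 of record untouched; K3⁸ OPEN; counts UNMOVED.  Restate-immune (no Theses import).
-/

noncomputable section

open scoped BigOperators Matrix Matrix.Norms.L2Operator

namespace Summit.QuantumFields.YangMills.BalabanUVNodes.N15.Gluing

open Real
open Literature.MathematicalPhysics.QuantumFieldTheory.Balaban1983to89
open Literature.MathematicalPhysics.QuantumFieldTheory.Balaban1983to89.B5Prop11Plancherel (Tor fine unitVec)
open Literature.MathematicalPhysics.QuantumFieldTheory.Balaban1983to89.B11SectG (BlockNorm HasMaj RowSum hasMaj_zero)
open Literature.MathematicalPhysics.QuantumFieldTheory.Balaban1983to89.B6RandomWalk (Triangle254)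
open Literature.MathematicalPhysics.QuantumFieldTheory.Balaban1983to89.B6UnitTorusCarrier (unitTorusGeo triangle254_unitTorusGeo rowSum_unitTorusGeo unitTorusGeo_dist_nonneg unitTorusGeo_dist_self)
open Literature.MathematicalPhysics.QuantumFieldTheory.Balaban1983to89.B9Eq335RegularityClasses (Reg335Cube)
open Summit.QuantumFields.YangMills.BalabanUVNodes.N15.CovLandau (cGreen cSop csavg hasMaj_csavg hasMaj_csavg_transpose)
open Summit.QuantumFields.YangMills.BalabanUVNodes.N15.BackgroundModel (kappa_ofBlocks)
open Literature.MathematicalPhysics.QuantumFieldTheory.King1986 (aK aK_pos)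
open Literature.MathematicalPhysics.QuantumFieldTheory.King1986.Torus (blockOf)
open Literature.Barriers.QuantumFields (traceForm)
open Summit.QuantumFields.YangMills.BalabanUVNodes.N15.MatrixSpecies (basisConst liftBlk)
open Summit.QuantumFields.YangMills.BalabanUVNodes.N15.TwoGrid (cubeBlocks hasMaj_smul_ofBlocks)

variable {d : ℕ}

section Row

variable {L : ℕ} [NeZero L]

/-- ★★ **THE ROW OF `Q′G′²Q′ᵀ(U)` AT ITS SCALE**: for a `U(m)` field in Bałaban's per-cube class (3.35) on the two-collar box of every cut box (n15-c∕266's hypotheses literally),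
`mulVecLin (cSop (cvT e U) a_K) ≤ B·(L^k)^{−(d+1)}·e^{−δ|y−y′|_T}` on the coarse coloured scalars — `Q′(U)` rows `|ι|` (n15-c∕202 with the orthogonal staircase transports), `G′(U) ≤ B₆e^{−δ₆d∕16}`
(n15-c∕266), `Q′(U)ᵀ` rows `(L^k)^{−(d+1)}|ι|` (n15-c∕205), composed by [B11] `hasMaj_comp_exp` after rescaling the right factor.  MODEL carriers; (3.25) ∕ (3.48) = SHAPES.
[cite: Balaban1985BackgroundPropagators, (3.25) p.394, Thm 3.2 (3.48) p.398, (3.35) p.396 (shapes); Balaban1984PropagatorsI, (1.20) p.20] -/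
theorem hasMaj_cSop_of_reg335Box (hL : Odd L ∧ 1 < L) (hL7 : 7 ≤ L) {a₀ : ℝ} (ha₀ : 0 < a₀) (ι : Type) [Fintype ι] [DecidableEq ι] :
    ∃ δ w₀ R₀ B : ℝ, 0 < δ ∧ 0 < R₀ ∧ 0 < B ∧
      ∀ (mv kk : ℕ), 1 ≤ kk → w₀ ≤ ((L ^ mv : ℕ) : ℝ) →
      ∀ {mm : Type} [Fintype mm] [DecidableEq mm] [Nonempty mm] (e : Matrix mm mm ℂ ≃L[ℝ] (ι → ℝ)), (∀ A B : Matrix mm mm ℂ, traceForm A B = e A ⬝ᵥ e B) →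
      ∀ (U : Fin (d + 1) → ScX d L mv kk hL → (Matrix mm mm ℂ)ˣ), (∀ μ x, (U μ x : Matrix mm mm ℂ) ∈ Matrix.unitaryGroup mm ℂ) →
      ∀ (ξ C : ℝ), 0 < ξ → 0 ≤ C →
        (∀ k, Reg335Cube (scShift d L mv kk hL) U ((((L ^ kk : ℕ) : ℝ))⁻¹) {x : ScX d L mv kk hL | blockOf (L ^ kk) (cvM d L mv kk hL) x ∈ cubeBlocks (cvM d L mv kk hL) (coverCorner (cvM d L mv kk hL) (L ^ mv) L (2 * L ^ mv + 1) k) (6 * L ^ mv + 3)} ξ C) →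
      ∀ (rV : ℝ), 0 ≤ rV →
        Fintype.card ι * (@basisConst ι _ (Matrix mm mm ℂ) Matrix.frobeniusNormedAddCommGroup Matrix.frobeniusNormedSpace e * (2 * Real.sqrt (Fintype.card mm)) * (Real.sqrt (Fintype.card mm) * ((C / ξ) * Real.exp (((((L ^ kk : ℕ) : ℝ))⁻¹) * (C / ξ))))) ≤ rV →
        Fintype.card ι * (Fintype.card (Fin (d + 1)) * (Fintype.card ι * (@basisConst ι _ (Matrix mm mm ℂ) Matrix.frobeniusNormedAddCommGroup Matrix.frobeniusNormedSpace e * (2 * Real.sqrt (Fintype.card mm)) * (Real.sqrt (Fintype.card mm) * ((C / ξ) * Real.exp (((((L ^ kk : ℕ) : ℝ))⁻¹) * (C / ξ))))) ^ 2 + @basisConst ι _ (Matrix mm mm ℂ) Matrix.frobeniusNormedAddCommGroup Matrix.frobeniusNormedSpace e * (2 * Real.sqrt (Fintype.card mm)) * (Real.sqrt (Fintype.card mm) * ((C / ξ ^ 2) * Real.exp (((((L ^ kk : ℕ) : ℝ))⁻¹) * (C / ξ)))))) ≤ rV →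
        rV * (1 + Fintype.card (Fin (d + 1) ⊕ Fin (d + 1))) + a₀ * (Fintype.card ι * (Fintype.card ι * ((1 + rV * ((((L ^ kk : ℕ) : ℝ))⁻¹)) ^ ((d + 1) * L ^ kk) - 1) ^ 2 + 2 * ((1 + rV * ((((L ^ kk : ℕ) : ℝ))⁻¹)) ^ ((d + 1) * L ^ kk) - 1))) ≤ R₀ →
        HasMaj (BlockNorm.ofBlocks (unitTorusGeo L kk (cvM d L mv kk hL)) (liftBlk (fun y : Tor (cvM d L mv kk hL) => y) ι)) (BlockNorm.ofBlocks (unitTorusGeo L kk (cvM d L mv kk hL)) (liftBlk (fun y : Tor (cvM d L mv kk hL) => y) ι))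
            (Matrix.mulVecLin (cSop (cvM d L mv kk hL) (L ^ kk) (cvT e (fun μ x => (U μ x : Matrix mm mm ℂ))) (aK a₀ (L : ℝ) kk * (((L ^ kk : ℕ) : ℝ)) ^ (d + 1))))
          (fun y y' => B * ((((L ^ kk : ℕ) : ℝ)) ^ (d + 1))⁻¹ * Real.exp (-(δ * (unitTorusGeo L kk (cvM d L mv kk hL)).dist y y'))) := by
  classical
  obtain ⟨δ₆, w₆, R₆, B₆, hδ₆, hR₆, hB₆, H₆⟩ := hasMaj_cGreen_of_reg335Box (d := d) hL hL7 ha₀ ι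
  -- rates: `δ₀ = δ₆∕16`, row-sum rate `m = δ₀∕8`, three convolution steps down to `δ₀ − 6m = δ₀∕4`
  set δ₀ : ℝ := δ₆ / 16 with hδ₀def
  have hδ₀ : 0 < δ₀ := by positivity
  set m : ℝ := δ₀ / 8 with hmdef
  have hm : 0 < m := by positivity
  set cr : ℝ := B4Sect5Proof.latticeConst (d + 1) m with hcrdef
  have hcr0 : 0 ≤ cr := B4Sect5Proof.latticeConst_nonneg (d + 1) hm.le
  set τ : ℝ := (Fintype.card ι : ℝ) + 1 with hτdef
  have hτ0 : 0 ≤ τ := by positivity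
  refine ⟨δ₀ - 6 * m, w₆, R₆, 1 * τ * (1 * B₆ * (1 * B₆ * τ * cr) * cr) * cr + 1, by rw [hmdef]; linarith, hR₆, by positivity, fun mv kk hk hw₀ => ?_⟩
  intro mm _ _ _ e he U hU ξ C hξ hC h335 rV hrV hrA hrC hRle
  have hU' : ∀ μ x, ((U μ x : Matrix mm mm ℂ))ᴴ * (U μ x : Matrix mm mm ℂ) = 1 := fun μ x => Matrix.mem_unitaryGroup_iff'.mp (hU μ x)
  have htri : Triangle254 (unitTorusGeo L kk (cvM d L mv kk hL)) := triangle254_unitTorusGeo L kk _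
  have hd : ∀ a b : Tor (cvM d L mv kk hL), 0 ≤ (unitTorusGeo L kk (cvM d L mv kk hL)).dist a b := unitTorusGeo_dist_nonneg L kk _
  have hd0 : ∀ y : Tor (cvM d L mv kk hL), (unitTorusGeo L kk (cvM d L mv kk hL)).dist y y = 0 := unitTorusGeo_dist_self L kk _
  have hrow : RowSum (unitTorusGeo L kk (cvM d L mv kk hL)) m cr := by rw [hcrdef]; exact rowSum_unitTorusGeo L kk _ hm
  have hnpos : (0 : ℝ) < ((L ^ kk : ℕ) : ℝ) ^ (d + 1) := by positivity
  have hκ : (ScNorm d L mv kk hL ι).κ = 1 := kappa_ofBlocks _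
  -- the three factors
  have hG : HasMaj (ScNorm d L mv kk hL ι) (ScNorm d L mv kk hL ι) (Matrix.mulVecLin (cGreen (cvM d L mv kk hL) (L ^ kk) (cvT e (fun μ x => (U μ x : Matrix mm mm ℂ))) (aK a₀ (L : ℝ) kk * (((L ^ kk : ℕ) : ℝ)) ^ (d + 1)))) (fun y y' => B₆ * Real.exp (-(δ₀ * (unitTorusGeo L kk (cvM d L mv kk hL)).dist y y'))) :=
    H₆ mv kk hk hw₀ e he U hU ξ C hξ hC h335 rV hrV hrA hrC hRle
  have hQ : HasMaj (ScNorm d L mv kk hL ι) (BlockNorm.ofBlocks (unitTorusGeo L kk (cvM d L mv kk hL)) (liftBlk (fun y : Tor (cvM d L mv kk hL) => y) ι)) (Matrix.mulVecLin (csavg (cvM d L mv kk hL) (L ^ kk) (cvT e (fun μ x => (U μ x : Matrix mm mm ℂ))))) (fun y y' => τ * Real.exp (-(δ₀ * (unitTorusGeo L kk (cvM d L mv kk hL)).dist y y'))) := by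
    have h := hasMaj_csavg (cvM d L mv kk hL) (L ^ kk) L kk (cvT e (fun μ x => (U μ x : Matrix mm mm ℂ))) (τ := τ) hτ0 fun y a i =>
      (rows_cvaStair_cvT_le (cvM d L mv kk hL) (L ^ kk) e he hU' y a 0 i).trans (by rw [hτdef]; linarith only [])
    exact HasMaj.diag_const_exp δ₀ hd0 hτ0 h
  have hR : HasMaj (BlockNorm.ofBlocks (unitTorusGeo L kk (cvM d L mv kk hL)) (liftBlk (fun y : Tor (cvM d L mv kk hL) => y) ι)) (ScNorm d L mv kk hL ι) (((((L ^ kk : ℕ) : ℝ)) ^ (d + 1)) • (Matrix.mulVecLin (csavg (cvM d L mv kk hL) (L ^ kk) (cvT e (fun μ x => (U μ x : Matrix mm mm ℂ))))ᵀ)) (fun y y' => τ * Real.exp (-(δ₀ * (unitTorusGeo L kk (cvM d L mv kk hL)).dist y y'))) := by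
    have h := hasMaj_csavg_transpose (cvM d L mv kk hL) (L ^ kk) L kk (cvT e (fun μ x => (U μ x : Matrix mm mm ℂ))) (τ := Fintype.card ι) (Nat.cast_nonneg _)
      fun y a i => cols_cvaStair_cvT_le (cvM d L mv kk hL) (L ^ kk) e he hU' y a 0 i
    have h1 := hasMaj_smul_ofBlocks (g := unitTorusGeo L kk (cvM d L mv kk hL)) (liftBlk (scBlk d L mv kk hL) ι) (K := fun w w' => if w = w' then ((((L ^ kk : ℕ) : ℝ)) ^ (d + 1))⁻¹ * (Fintype.card ι : ℝ) else 0) (fun w w' => by split_ifs <;> positivity) ((((L ^ kk : ℕ) : ℝ)) ^ (d + 1)) h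
    have h2 : HasMaj (BlockNorm.ofBlocks (unitTorusGeo L kk (cvM d L mv kk hL)) (liftBlk (fun y : Tor (cvM d L mv kk hL) => y) ι)) (ScNorm d L mv kk hL ι) (((((L ^ kk : ℕ) : ℝ)) ^ (d + 1)) • (Matrix.mulVecLin (csavg (cvM d L mv kk hL) (L ^ kk) (cvT e (fun μ x => (U μ x : Matrix mm mm ℂ))))ᵀ)) (fun w w' => if w = w' then τ else 0) := h1.mono fun w w' => by
      split_ifs
      · rw [abs_of_pos hnpos, ← mul_assoc, mul_inv_cancel₀ hnpos.ne', one_mul, hτdef]; linarith only []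
      · rw [mul_zero]
    exact HasMaj.diag_const_exp δ₀ hd0 hτ0 h2
  -- compose (rates `δ₀ − 2m`, `δ₀ − 4m`, `δ₀ − 6m`) and scale back
  have hGR : HasMaj (BlockNorm.ofBlocks (unitTorusGeo L kk (cvM d L mv kk hL)) (liftBlk (fun y : Tor (cvM d L mv kk hL) => y) ι)) (ScNorm d L mv kk hL ι) ((Matrix.mulVecLin (cGreen (cvM d L mv kk hL) (L ^ kk) (cvT e (fun μ x => (U μ x : Matrix mm mm ℂ))) (aK a₀ (L : ℝ) kk * (((L ^ kk : ℕ) : ℝ)) ^ (d + 1)))) ∘ₗ (((((L ^ kk : ℕ) : ℝ)) ^ (d + 1)) • (Matrix.mulVecLin (csavg (cvM d L mv kk hL) (L ^ kk) (cvT e (fun μ x => (U μ x : Matrix mm mm ℂ))))ᵀ))) (fun y y' => (ScNorm d L mv kk hL ι).κ * B₆ * τ * cr * Real.exp (-((δ₀ - 2 * m) * (unitTorusGeo L kk (cvM d L mv kk hL)).dist y y'))) :=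
    B11SectG.hasMaj_comp_exp htri hd hrow hB₆.le hτ0 (by linarith) (by linarith) (by linarith) hG hR
  have hGGR : HasMaj (BlockNorm.ofBlocks (unitTorusGeo L kk (cvM d L mv kk hL)) (liftBlk (fun y : Tor (cvM d L mv kk hL) => y) ι)) (ScNorm d L mv kk hL ι) ((Matrix.mulVecLin (cGreen (cvM d L mv kk hL) (L ^ kk) (cvT e (fun μ x => (U μ x : Matrix mm mm ℂ))) (aK a₀ (L : ℝ) kk * (((L ^ kk : ℕ) : ℝ)) ^ (d + 1)))) ∘ₗ ((Matrix.mulVecLin (cGreen (cvM d L mv kk hL) (L ^ kk) (cvT e (fun μ x => (U μ x : Matrix mm mm ℂ))) (aK a₀ (L : ℝ) kk * (((L ^ kk : ℕ) : ℝ)) ^ (d + 1)))) ∘ₗ (((((L ^ kk : ℕ) : ℝ)) ^ (d + 1)) • (Matrix.mulVecLin (csavg (cvM d L mv kk hL) (L ^ kk) (cvT e (fun μ x => (U μ x : Matrix mm mm ℂ))))ᵀ)))) (fun y y' => (ScNorm d L mv kk hL ι).κ * B₆ * ((ScNorm d L mv kk hL ι).κ * B₆ * τ * cr) * cr * Real.exp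 (-((δ₀ - 4 * m) * (unitTorusGeo L kk (cvM d L mv kk hL)).dist y y'))) :=
    B11SectG.hasMaj_comp_exp htri hd hrow hB₆.le (by rw [hκ]; positivity) (by linarith) (by linarith) (by linarith) hG hGR
  have hQGGR : HasMaj (BlockNorm.ofBlocks (unitTorusGeo L kk (cvM d L mv kk hL)) (liftBlk (fun y : Tor (cvM d L mv kk hL) => y) ι)) (BlockNorm.ofBlocks (unitTorusGeo L kk (cvM d L mv kk hL)) (liftBlk (fun y : Tor (cvM d L mv kk hL) => y) ι)) ((Matrix.mulVecLin (csavg (cvM d L mv kk hL) (L ^ kk) (cvT e (fun μ x => (U μ x : Matrix mm mm ℂ))))) ∘ₗ ((Matrix.mulVecLin (cGreen (cvM d L mv kk hL) (L ^ kk) (cvT e (fun μ x => (U μ x : Matrix mm mm ℂ))) (aK a₀ (L : ℝ) kk * (((L ^ kk : ℕ) : ℝ)) ^ (d + 1)))) ∘ₗ ((Matrix.mulVecLin (cGreen (cvM d L mv kk hL) (L ^ kk) (cvT e (fun μ x => (U μ x : Matrix mm mm ℂ))) (aK a₀ (L : ℝ) kk * (((L ^ kk : ℕ) : ℝ)) ^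 (d + 1)))) ∘ₗ (((((L ^ kk : ℕ) : ℝ)) ^ (d + 1)) • (Matrix.mulVecLin (csavg (cvM d L mv kk hL) (L ^ kk) (cvT e (fun μ x => (U μ x : Matrix mm mm ℂ))))ᵀ))))) (fun y y' => (ScNorm d L mv kk hL ι).κ * τ * ((ScNorm d L mv kk hL ι).κ * B₆ * ((ScNorm d L mv kk hL ι).κ * B₆ * τ * cr) * cr) * cr * Real.exp (-((δ₀ - 6 * m) * (unitTorusGeo L kk (cvM d L mv kk hL)).dist y y'))) :=
    B11SectG.hasMaj_comp_exp htri hd hrow hτ0 (by rw [hκ]; positivity) (by linarith) (by linarith) (by linarith) hQ hGGR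
  have hcS : Matrix.mulVecLin (cSop (cvM d L mv kk hL) (L ^ kk) (cvT e (fun μ x => (U μ x : Matrix mm mm ℂ))) (aK a₀ (L : ℝ) kk * (((L ^ kk : ℕ) : ℝ)) ^ (d + 1))) =
      ((((L ^ kk : ℕ) : ℝ)) ^ (d + 1))⁻¹ • ((Matrix.mulVecLin (csavg (cvM d L mv kk hL) (L ^ kk) (cvT e (fun μ x => (U μ x : Matrix mm mm ℂ))))) ∘ₗ ((Matrix.mulVecLin (cGreen (cvM d L mv kk hL) (L ^ kk) (cvT e (fun μ x => (U μ x : Matrix mm mm ℂ))) (aK a₀ (L : ℝ) kk * (((L ^ kk : ℕ) : ℝ)) ^ (d + 1)))) ∘ₗ ((Matrix.mulVecLin (cGreen (cvM d L mv kk hL) (L ^ kk) (cvT e (fun μ x => (U μ x : Matrix mm mm ℂ))) (aK a₀ (L : ℝ) kk * (((L ^ kk : ℕ) : ℝ)) ^ (d + 1)))) ∘ₗ (((((L ^ kk : ℕ) : ℝ)) ^ (d + 1)) • (Matrix.mulVecLin (csavg (cvM d L mv kk hL) (L ^ kk) (cvT e (fun μ x => (U μ x : Matrix mm mm ℂ))))ᵀ)))))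 := by
    rw [cSop, Matrix.mulVecLin_mul, Matrix.mulVecLin_mul, Matrix.mulVecLin_mul, LinearMap.comp_smul, LinearMap.comp_smul, LinearMap.comp_smul, smul_smul, inv_mul_cancel₀ hnpos.ne', one_smul]
    rfl
  rw [hcS]
  refine (hasMaj_smul_ofBlocks (g := unitTorusGeo L kk (cvM d L mv kk hL)) (liftBlk (fun y : Tor (cvM d L mv kk hL) => y) ι)
    (K := fun y y' => (ScNorm d L mv kk hL ι).κ * τ * ((ScNorm d L mv kk hL ι).κ * B₆ * ((ScNorm d L mv kk hL ι).κ * B₆ * τ * cr) * cr) * cr * Real.exp (-((δ₀ - 6 * m) * (unitTorusGeo L kk (cvM d L mv kk hL)).dist y y')))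
    (fun y y' => by rw [hκ]; positivity) ((((L ^ kk : ℕ) : ℝ)) ^ (d + 1))⁻¹ hQGGR).mono fun y y' => ?_
  rw [abs_of_pos (inv_pos.2 hnpos), hκ]
  have hE := Real.exp_nonneg (-((δ₀ - 6 * m) * (unitTorusGeo L kk (cvM d L mv kk hL)).dist y y'))
  have hK0 : 0 ≤ 1 * τ * (1 * B₆ * (1 * B₆ * τ * cr) * cr) * cr := by positivity
  nlinarith only [hE, hK0, inv_pos.2 hnpos]


end Row

end Summit.QuantumFields.YangMills.BalabanUVNodes.N15.Gluing

end
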